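import Literature.AnabelianGeometry.EtaleTheta.TorsorSystems

/-!
# [EtTh] Prop. 2.15 (i), second sentence: the induced map `Aut_𝒯(T_{M'}) → Aut_𝒯(T_M)` IS an
# injective group homomorphism (proof-only companion of `TorsorSystems.lean`)

Mochizuki, *The étale theta function and its Frobenioid-theoretic manifestations*, Publ. RIMS **45**
(2009) [EtTh], §2, Prop. 2.15 (i), PRIMS PDF p. 52 (printed 278) l. 36–45 (own render
paper:doi-10-2977-prims-1234361159 p0052): "(i) (Groups of Automorphisms) If `M ∈ ℕ≥1`, then we have a
natural isomorphism `Aut_𝒯(T_M) ⥲ M·ℤ`. If `M, M′ ∈ ℕ≥1`, then any morphism `φ : T_{M′} → T_M` of `𝒯`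
induces [via the condition of compatibility with `φ`] the injection
`Aut_𝒯(T_{M′}) ⥲ M′·ℤ ↪ M·ℤ ⥲ Aut_𝒯(T_M)` determined by the natural inclusion `M′·ℤ ⊆ M·ℤ`."
[cite: MochizukiEtTh2009, Prop 2.15(i) p.52]

abc-iut cell, layer L2 cone row **EtTh:Prop2.15(i)**; seat abc-iut-w4-d038 (gen 4). PROOF-ONLY companion (no
definition, no named fact) of abc-iut-L2-t2's `TorsorSystems.lean` (p403826), which defines the induced map
`TObj.autRestrict φ` and proves that it is THE `φ`-compatible automorphism (`autRestrict_comm`,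
`comm_iff_shift_eq`) and the bijection `autShiftEquiv : Aut_𝒯(T_M) ≃ M·ℤ`. The printed word "injection"
and the implicit "homomorphism of groups" are made literal here:
* `TObj.autRestrict_shift` — `autRestrict φ a` has the same shift as `a` (the square through `M′·ℤ ⊆ M·ℤ`);
* `TObj.autRestrict_unique` — "[via the condition of compatibility with `φ`]": a `φ`-compatible
  automorphism of `T_M` IS `autRestrict φ a`;
* `TObj.autRestrict_mul` / `autRestrict_one` — the induced map is a homomorphism of groups;
* `TObj.autRestrict_injective` — it is injective.
HONEST FRAMING: elementary bookkeeping on t2's definitions; [EtTh] is refereed; nothing here takes a side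
on [IUTchIII] Cor. 3.12; typed ≠ discharged.
-/

namespace Literature.AnabelianGeometry.EtaleTheta

open CategoryTheory

namespace TObj

variable {A B : TObj} (φ : A ⟶ B)

/-- The induced automorphism of `T_M` translates by the SAME integer as `a` does on `T_{M′}` — the
square `Aut(T_{M′}) ⥲ M′·ℤ ⊆ M·ℤ ⥲ Aut(T_M)` of Prop. 2.15 (i) commutes.
[cite: MochizukiEtTh2009, Prop 2.15(i) p.52] -/
@[simp] theorem autRestrict_shift (a : Aut A) : (autRestrict φ a).hom.shift = a.hom.shift := rfl

/-- "[via the condition of compatibility with `φ`]": the `φ`-compatible automorphism of `T_M` is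
unique, namely `autRestrict φ a`. [cite: MochizukiEtTh2009, Prop 2.15(i) p.52] -/
theorem autRestrict_unique (a : Aut A) (b : Aut B) (h : a.hom ≫ φ = φ ≫ b.hom) :
    b = autRestrict φ a := by
  have hs : a.hom.shift = b.hom.shift := (comm_iff_shift_eq φ a.hom b.hom).mp h
  apply (autShiftEquiv B).injective
  apply Subtype.ext
  change b.hom.shift = (autRestrict φ a).hom.shift
  rw [autRestrict_shift, hs]

/-- The induced map `Aut_𝒯(T_{M′}) → Aut_𝒯(T_M)` preserves the identity.
[cite: MochizukiEtTh2009, Prop 2.15(i) p.52] -/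
@[simp] theorem autRestrict_one : autRestrict φ (1 : Aut A) = 1 := by
  apply (autShiftEquiv B).injective
  apply Subtype.ext
  change (autRestrict φ 1).hom.shift = (1 : Aut B).hom.shift
  rfl

/-- The induced map `Aut_𝒯(T_{M′}) → Aut_𝒯(T_M)` is a homomorphism of groups (composition of
translations = addition of shifts on both sides). [cite: MochizukiEtTh2009, Prop 2.15(i) p.52] -/
theorem autRestrict_mul (a a' : Aut A) :
    autRestrict φ (a * a') = autRestrict φ a * autRestrict φ a' := by
  apply (autShiftEquiv B).injective
  apply Subtype.ext
  change (autRestrict φ (a * a')).hom.shift = (autRestrict φ a * autRestrict φ a').hom.shift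
  simp only [autRestrict_shift, Aut.Aut_mul_def, Iso.trans_hom, comp_shift]

/-- **Prop. 2.15 (i), "the injection `Aut_𝒯(T_{M′}) ↪ Aut_𝒯(T_M)`"**: the induced map is injective
(an automorphism is determined by its shift, `autShiftEquiv`). [cite: MochizukiEtTh2009, Prop 2.15(i) p.52] -/
theorem autRestrict_injective : Function.Injective (autRestrict φ) := by
  intro a a' h
  have hs : (autRestrict φ a).hom.shift = (autRestrict φ a').hom.shift := by rw [h]
  rw [autRestrict_shift, autRestrict_shift] at hs
  apply (autShiftEquiv A).injective
  exact Subtype.ext hs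

/-- The induced map as seen through the isomorphisms `Aut_𝒯(T_•) ⥲ (•)·ℤ`: it is literally the
inclusion `M′·ℤ ⊆ M·ℤ` on shifts. [cite: MochizukiEtTh2009, Prop 2.15(i) p.52] -/
theorem autShiftEquiv_autRestrict (a : Aut A) :
    ((autShiftEquiv B (autRestrict φ a) : {k : ℤ // (B.idx : ℤ) ∣ k}) : ℤ) =
      ((autShiftEquiv A a : {k : ℤ // (A.idx : ℤ) ∣ k}) : ℤ) := rfl

end TObj

end Literature.AnabelianGeometry.EtaleTheta
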